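/- Fleet lead `ym-wcr-19456-p1` (seat g2), route `WeakCouplingRates`, crux `ColdBoxTwoPointFloorW` (stmt-QuantumFields-19608). -/
-- tree-module: Summits.QuantumFields.YangMills.Theorems.WeakCouplingRatesColdBoxCovBookkeeping
import Summits.QuantumFields.YangMills.Theorems.WeakCouplingRatesColdBoxTilt
import Summits.QuantumFields.YangMills.Theorems.WeakCouplingRatesColdBoxGoodEvent
import Mathlib.MeasureTheory.Function.L2Space

/-!
# Crux `ColdBoxTwoPointFloorW`, stub `stub_boxGaussianDomination`, brick R6: COVARIANCE BOOKKEEPING — from the tilted conditioned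
# reference to the reference, for observables close to square-integrable surrogates on the good event

Abstract probability (no lattice objects).  `γ` a probability measure, `S` a measurable event with `γ(Sᶜ) ≤ p` and `γ(S) ≠ 0`, `W` a
measurable tilt with `|𝟙_S W| ≤ w`, `ν := (γ[|S]).tilted (𝟙_S W)`.  Observables `F, G` with `0 ≤ F, G ≤ M` on `S`, surrogates `Q₁, Q₂`
with `|F − Q₁|, |G − Q₂| ≤ τ` on `S` and second moments `∫Q₁², ∫Q₂² ≤ K²`, `∫(Q₁Q₂)² ≤ K'²`.  Then
**`abs_cov_tilted_cond_sub_cov_le`**: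
`|Cov_ν(F,G) − Cov_γ(Q₁,Q₂)| ≤ 3M²(e^{2w} − 1) + 6M²p + 2τ(M + K) + √p·(2MK + K' + K²)`.
Steps: `ν` and `γ[|S]` live on `S`, so `F, G` may be replaced by `𝟙_S F, 𝟙_S G` (bounded by `M`); the tilt costs `3M²(e^{2w}−1)`
(`abs_cov_tilted_sub_le`, p445518); the conditioning costs `6M²p` (`abs_cov_sub_cov_cond_le`, p444138); and under `γ`,
`|𝟙_S F − Q₁| ≤ τ + 𝟙_{Sᶜ}|Q₁|` with `∫ 𝟙_{Sᶜ}|Q| ≤ √p·‖Q‖₂` (Cauchy–Schwarz), which gives the last two terms by bilinearity.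
No sorry; no new definition; standard axioms.  NOT a claim about the mass gap.
-/

set_option autoImplicit false

noncomputable section

open MeasureTheory ProbabilityTheory Real

namespace Summit.QuantumFields.YangMills.Theorems.WeakCouplingRates

variable {Ω : Type*} [MeasurableSpace Ω] {γ : Measure Ω} [IsProbabilityMeasure γ]

omit [IsProbabilityMeasure γ] in
/-- A bounded measurable real function is integrable for a finite measure. -/
theorem integrable_of_abs_le [IsFiniteMeasure γ] {f : Ω → ℝ} (hf : AEStronglyMeasurable f γ) {C : ℝ} (hC : ∀ x, |f x| ≤ C) :
    Integrable f γ :=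
  Integrable.mono' (integrable_const C) hf (ae_of_all _ fun x => by simpa [Real.norm_eq_abs] using hC x)

/-! ## Cauchy–Schwarz against the indicator of a small set -/

/-- `∫ 𝟙_A · |Q| ≤ √(γ(A)) · √(∫ Q²)` for `Q ∈ L²`. -/
theorem integral_indicator_mul_abs_le_sqrt {A : Set Ω} (hA : MeasurableSet A) {Q : Ω → ℝ} (hQ : MemLp Q 2 γ) :
    ∫ ω, A.indicator (fun _ => (1 : ℝ)) ω * |Q ω| ∂γ ≤ Real.sqrt (γ.real A) * Real.sqrt (∫ ω, Q ω ^ 2 ∂γ) := by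
  have hind : MemLp (fun ω => A.indicator (fun _ => (1 : ℝ)) ω) (ENNReal.ofReal 2) γ := by
    rw [show ENNReal.ofReal 2 = 2 by norm_num]
    exact (memLp_const 1).indicator hA
  have hQ' : MemLp (fun ω => |Q ω|) (ENNReal.ofReal 2) γ := by
    rw [show ENNReal.ofReal 2 = 2 by norm_num]; exact hQ.abs
  have h := integral_mul_le_Lp_mul_Lq_of_nonneg Real.HolderConjugate.two_two
    (ae_of_all _ fun ω => Set.indicator_nonneg (fun _ _ => zero_le_one) _) (ae_of_all _ fun ω => abs_nonneg _) hind hQ'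
  have h1 : ∫ ω, A.indicator (fun _ => (1 : ℝ)) ω ^ (2 : ℝ) ∂γ = γ.real A := by
    have : ∀ ω, A.indicator (fun _ => (1 : ℝ)) ω ^ (2 : ℝ) = A.indicator (fun _ => (1 : ℝ)) ω := fun ω => by
      by_cases hω : ω ∈ A <;> simp [hω]
    simp_rw [this]
    rw [integral_indicator hA, setIntegral_const, smul_eq_mul, mul_one]
  have h2 : ∫ ω, |Q ω| ^ (2 : ℝ) ∂γ = ∫ ω, Q ω ^ 2 ∂γ := by
    refine integral_congr_ae (ae_of_all _ fun ω => ?_)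
    dsimp only
    rw [Real.rpow_two, sq_abs]
  rw [h1, h2] at h
  simpa [Real.sqrt_eq_rpow] using h

/-- `∫ |Q| ≤ √(∫ Q²)` for `Q ∈ L²` (probability measure). -/
theorem integral_abs_le_sqrt {Q : Ω → ℝ} (hQ : MemLp Q 2 γ) : ∫ ω, |Q ω| ∂γ ≤ Real.sqrt (∫ ω, Q ω ^ 2 ∂γ) := by
  have h := integral_indicator_mul_abs_le_sqrt (γ := γ) MeasurableSet.univ hQ
  simp only [Set.indicator_univ, one_mul, probReal_univ, Real.sqrt_one] at h
  exact h

/-! ## Bilinear bookkeeping under the reference measure -/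

/-- **Surrogate replacement under `γ`.**  If `|F'|, |G'| ≤ M` everywhere, `|F' − Q₁| ≤ τ + 𝟙_{Sᶜ}|Q₁|` and `|G' − Q₂| ≤ τ + 𝟙_{Sᶜ}|Q₂|`
pointwise, `γ(Sᶜ) ≤ p`, `∫Q₁², ∫Q₂² ≤ K²`, `∫(Q₁Q₂)² ≤ K'²`, then
`|Cov_γ(F',G') − Cov_γ(Q₁,Q₂)| ≤ 2τ(M + K) + √p·(2MK + K' + K²)`. -/
theorem abs_cov_sub_cov_surrogate_le {S : Set Ω} (hS : MeasurableSet S) {F' G' Q₁ Q₂ : Ω → ℝ}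
    (hF'm : Measurable F') (hG'm : Measurable G') (hQ₁ : MemLp Q₁ 2 γ) (hQ₂ : MemLp Q₂ 2 γ)
    (hQ₁₂ : MemLp (fun ω => Q₁ ω * Q₂ ω) 2 γ) {M τ K K' p : ℝ} (hM : 0 ≤ M) (hτ : 0 ≤ τ) (hK : 0 ≤ K) (hK' : 0 ≤ K')
    (hF' : ∀ ω, |F' ω| ≤ M) (hG' : ∀ ω, |G' ω| ≤ M)
    (hFQ : ∀ ω, |F' ω - Q₁ ω| ≤ τ + Sᶜ.indicator (fun ω => |Q₁ ω|) ω)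
    (hGQ : ∀ ω, |G' ω - Q₂ ω| ≤ τ + Sᶜ.indicator (fun ω => |Q₂ ω|) ω)
    (hp : γ.real Sᶜ ≤ p) (hK₁ : ∫ ω, Q₁ ω ^ 2 ∂γ ≤ K ^ 2) (hK₂ : ∫ ω, Q₂ ω ^ 2 ∂γ ≤ K ^ 2)
    (hK₁₂ : ∫ ω, (Q₁ ω * Q₂ ω) ^ 2 ∂γ ≤ K' ^ 2) :
    |((∫ ω, F' ω * G' ω ∂γ) - (∫ ω, F' ω ∂γ) * (∫ ω, G' ω ∂γ)) -
        ((∫ ω, Q₁ ω * Q₂ ω ∂γ) - (∫ ω, Q₁ ω ∂γ) * (∫ ω, Q₂ ω ∂γ))| ≤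
      2 * τ * (M + K) + Real.sqrt p * (2 * M * K + K' + K ^ 2) := by
  -- integrability
  have hF'i : Integrable F' γ := integrable_of_abs_le hF'm.aestronglyMeasurable hF'
  have hG'i : Integrable G' γ := integrable_of_abs_le hG'm.aestronglyMeasurable hG'
  have hQ₁i : Integrable Q₁ γ := hQ₁.integrable one_le_two
  have hQ₂i : Integrable Q₂ γ := hQ₂.integrable one_le_two
  have hQ₁₂i : Integrable (fun ω => Q₁ ω * Q₂ ω) γ := hQ₁₂.integrable one_le_two
  have hF'G'i : Integrable (fun ω => F' ω * G' ω) γ :=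
    hG'i.bdd_mul hF'm.aestronglyMeasurable (ae_of_all _ fun ω => by rw [Real.norm_eq_abs]; exact hF' ω)
  have hQ₁G'i : Integrable (fun ω => Q₁ ω * G' ω) γ :=
    hQ₁i.mul_bdd hG'm.aestronglyMeasurable (ae_of_all _ fun ω => by rw [Real.norm_eq_abs]; exact hG' ω)
  set X : Ω → ℝ := fun ω => F' ω - Q₁ ω with hX
  set Y : Ω → ℝ := fun ω => G' ω - Q₂ ω with hY
  have hXi : Integrable X γ := hF'i.sub hQ₁i
  have hYi : Integrable Y γ := hG'i.sub hQ₂i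
  have hXG'i : Integrable (fun ω => X ω * G' ω) γ :=
    hXi.mul_bdd hG'm.aestronglyMeasurable (ae_of_all _ fun ω => by rw [Real.norm_eq_abs]; exact hG' ω)
  have hQ₁Yi : Integrable (fun ω => Q₁ ω * Y ω) γ := by
    have : (fun ω => Q₁ ω * Y ω) = fun ω => Q₁ ω * G' ω - Q₁ ω * Q₂ ω := by funext ω; simp only [hY]; ring
    rw [this]; exact hQ₁G'i.sub hQ₁₂i
  -- Cauchy–Schwarz pieces
  have hsp : Real.sqrt (γ.real Sᶜ) ≤ Real.sqrt p := Real.sqrt_le_sqrt hp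
  have hsK₁ : Real.sqrt (∫ ω, Q₁ ω ^ 2 ∂γ) ≤ K := by rw [← Real.sqrt_sq hK]; exact Real.sqrt_le_sqrt hK₁
  have hsK₂ : Real.sqrt (∫ ω, Q₂ ω ^ 2 ∂γ) ≤ K := by rw [← Real.sqrt_sq hK]; exact Real.sqrt_le_sqrt hK₂
  have hsK₁₂ : Real.sqrt (∫ ω, (Q₁ ω * Q₂ ω) ^ 2 ∂γ) ≤ K' := by rw [← Real.sqrt_sq hK']; exact Real.sqrt_le_sqrt hK₁₂
  have hCS₁ : ∫ ω, Sᶜ.indicator (fun _ => (1 : ℝ)) ω * |Q₁ ω| ∂γ ≤ Real.sqrt p * K :=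
    (integral_indicator_mul_abs_le_sqrt hS.compl hQ₁).trans (mul_le_mul hsp hsK₁ (Real.sqrt_nonneg _) (Real.sqrt_nonneg _))
  have hCS₂ : ∫ ω, Sᶜ.indicator (fun _ => (1 : ℝ)) ω * |Q₂ ω| ∂γ ≤ Real.sqrt p * K :=
    (integral_indicator_mul_abs_le_sqrt hS.compl hQ₂).trans (mul_le_mul hsp hsK₂ (Real.sqrt_nonneg _) (Real.sqrt_nonneg _))
  have hCS₁₂ : ∫ ω, Sᶜ.indicator (fun _ => (1 : ℝ)) ω * |Q₁ ω * Q₂ ω| ∂γ ≤ Real.sqrt p * K' :=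
    (integral_indicator_mul_abs_le_sqrt hS.compl hQ₁₂).trans (mul_le_mul hsp hsK₁₂ (Real.sqrt_nonneg _) (Real.sqrt_nonneg _))
  have hEQ₁ : ∫ ω, |Q₁ ω| ∂γ ≤ K := (integral_abs_le_sqrt hQ₁).trans hsK₁
  -- indicator rewriting: `𝟙_{Sᶜ}|Q| = 𝟙_{Sᶜ}·|Q|`
  have hind : ∀ (Q : Ω → ℝ) (ω : Ω), Sᶜ.indicator (fun ω => |Q ω|) ω = Sᶜ.indicator (fun _ => (1 : ℝ)) ω * |Q ω| := by
    intro Q ω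
    by_cases hω : ω ∈ Sᶜ
    · rw [Set.indicator_of_mem hω, Set.indicator_of_mem hω, one_mul]
    · rw [Set.indicator_of_notMem hω, Set.indicator_of_notMem hω, zero_mul]
  have hind1 : ∀ ω : Ω, ‖Sᶜ.indicator (fun _ => (1 : ℝ)) ω‖ ≤ 1 := fun ω => by
    by_cases hω : ω ∈ Sᶜ
    · rw [Set.indicator_of_mem hω]; simp
    · rw [Set.indicator_of_notMem hω]; simp
  -- E|X| ≤ τ + √p K,  E|Y| ≤ τ + √p K
  have hi1 : Integrable (fun ω => Sᶜ.indicator (fun _ => (1 : ℝ)) ω * |Q₁ ω|) γ :=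
    hQ₁i.abs.bdd_mul (c := 1) ((measurable_const.indicator hS.compl).aestronglyMeasurable) (ae_of_all _ hind1)
  have hi2 : Integrable (fun ω => Sᶜ.indicator (fun _ => (1 : ℝ)) ω * |Q₂ ω|) γ :=
    hQ₂i.abs.bdd_mul (c := 1) ((measurable_const.indicator hS.compl).aestronglyMeasurable) (ae_of_all _ hind1)
  have hi12 : Integrable (fun ω => Sᶜ.indicator (fun _ => (1 : ℝ)) ω * |Q₁ ω * Q₂ ω|) γ :=
    hQ₁₂i.abs.bdd_mul (c := 1) ((measurable_const.indicator hS.compl).aestronglyMeasurable) (ae_of_all _ hind1)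
  have hEX : ∫ ω, |X ω| ∂γ ≤ τ + Real.sqrt p * K := by
    calc ∫ ω, |X ω| ∂γ ≤ ∫ ω, (τ + Sᶜ.indicator (fun _ => (1 : ℝ)) ω * |Q₁ ω|) ∂γ :=
          integral_mono hXi.abs ((integrable_const τ).add hi1) fun ω => by rw [← hind]; exact hFQ ω
      _ = τ + ∫ ω, Sᶜ.indicator (fun _ => (1 : ℝ)) ω * |Q₁ ω| ∂γ := by
          rw [integral_add (integrable_const τ) hi1, integral_const, smul_eq_mul, probReal_univ, one_mul]
      _ ≤ τ + Real.sqrt p * K := by linarith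
  have hEY : ∫ ω, |Y ω| ∂γ ≤ τ + Real.sqrt p * K := by
    calc ∫ ω, |Y ω| ∂γ ≤ ∫ ω, (τ + Sᶜ.indicator (fun _ => (1 : ℝ)) ω * |Q₂ ω|) ∂γ :=
          integral_mono hYi.abs ((integrable_const τ).add hi2) fun ω => by rw [← hind]; exact hGQ ω
      _ = τ + ∫ ω, Sᶜ.indicator (fun _ => (1 : ℝ)) ω * |Q₂ ω| ∂γ := by
          rw [integral_add (integrable_const τ) hi2, integral_const, smul_eq_mul, probReal_univ, one_mul]
      _ ≤ τ + Real.sqrt p * K := by linarith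
  -- E[|Q₁||Y|] ≤ τ K + √p K'
  have hEQ₁Y : ∫ ω, |Q₁ ω * Y ω| ∂γ ≤ τ * K + Real.sqrt p * K' := by
    have hii : Integrable (fun ω => τ * |Q₁ ω| + Sᶜ.indicator (fun _ => (1 : ℝ)) ω * |Q₁ ω * Q₂ ω|) γ :=
      (hQ₁i.abs.const_mul τ).add hi12
    calc ∫ ω, |Q₁ ω * Y ω| ∂γ ≤ ∫ ω, (τ * |Q₁ ω| + Sᶜ.indicator (fun _ => (1 : ℝ)) ω * |Q₁ ω * Q₂ ω|) ∂γ := by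
          refine integral_mono hQ₁Yi.abs hii fun ω => ?_
          have h1 := hGQ ω
          rw [hind] at h1
          have hq := abs_nonneg (Q₁ ω)
          calc |Q₁ ω * Y ω| = |Q₁ ω| * |Y ω| := abs_mul _ _
            _ ≤ |Q₁ ω| * (τ + Sᶜ.indicator (fun _ => (1 : ℝ)) ω * |Q₂ ω|) := mul_le_mul_of_nonneg_left h1 hq
            _ = τ * |Q₁ ω| + Sᶜ.indicator (fun _ => (1 : ℝ)) ω * |Q₁ ω * Q₂ ω| := by rw [abs_mul]; ring
      _ = τ * ∫ ω, |Q₁ ω| ∂γ + ∫ ω, Sᶜ.indicator (fun _ => (1 : ℝ)) ω * |Q₁ ω * Q₂ ω| ∂γ := by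
          rw [integral_add (hQ₁i.abs.const_mul τ) hi12, integral_const_mul]
      _ ≤ τ * K + Real.sqrt p * K' := add_le_add (mul_le_mul_of_nonneg_left hEQ₁ hτ) hCS₁₂
  -- the four pieces
  have hA : |∫ ω, X ω * G' ω ∂γ| ≤ M * (τ + Real.sqrt p * K) := by
    calc |∫ ω, X ω * G' ω ∂γ| ≤ ∫ ω, |X ω * G' ω| ∂γ := abs_integral_le_integral_abs
      _ ≤ ∫ ω, M * |X ω| ∂γ := integral_mono hXG'i.abs (hXi.abs.const_mul M) fun ω => by
          rw [abs_mul, mul_comm]; exact mul_le_mul_of_nonneg_right (hG' ω) (abs_nonneg _)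
      _ = M * ∫ ω, |X ω| ∂γ := integral_const_mul _ _
      _ ≤ M * (τ + Real.sqrt p * K) := mul_le_mul_of_nonneg_left hEX hM
  have hB : |(∫ ω, X ω ∂γ) * (∫ ω, G' ω ∂γ)| ≤ (τ + Real.sqrt p * K) * M := by
    rw [abs_mul]
    refine mul_le_mul ((abs_integral_le_integral_abs).trans hEX) ?_ (abs_nonneg _) (by positivity)
    calc |∫ ω, G' ω ∂γ| ≤ ∫ ω, |G' ω| ∂γ := abs_integral_le_integral_abs
      _ ≤ ∫ _, M ∂γ := integral_mono hG'i.abs (integrable_const M) hG'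
      _ = M := by rw [integral_const, smul_eq_mul, probReal_univ, one_mul]
  have hC : |∫ ω, Q₁ ω * Y ω ∂γ| ≤ τ * K + Real.sqrt p * K' := (abs_integral_le_integral_abs).trans hEQ₁Y
  have hD : |(∫ ω, Q₁ ω ∂γ) * (∫ ω, Y ω ∂γ)| ≤ K * (τ + Real.sqrt p * K) := by
    rw [abs_mul]
    exact mul_le_mul ((abs_integral_le_integral_abs).trans hEQ₁) ((abs_integral_le_integral_abs).trans hEY)
      (abs_nonneg _) hK
  -- the identity
  have hsplit : ((∫ ω, F' ω * G' ω ∂γ) - (∫ ω, F' ω ∂γ) * (∫ ω, G' ω ∂γ)) -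
      ((∫ ω, Q₁ ω * Q₂ ω ∂γ) - (∫ ω, Q₁ ω ∂γ) * (∫ ω, Q₂ ω ∂γ)) =
      ((∫ ω, X ω * G' ω ∂γ) - (∫ ω, X ω ∂γ) * (∫ ω, G' ω ∂γ)) +
        ((∫ ω, Q₁ ω * Y ω ∂γ) - (∫ ω, Q₁ ω ∂γ) * (∫ ω, Y ω ∂γ)) := by
    have e1 : ∫ ω, X ω * G' ω ∂γ = (∫ ω, F' ω * G' ω ∂γ) - ∫ ω, Q₁ ω * G' ω ∂γ := by
      rw [← integral_sub hF'G'i hQ₁G'i]; refine integral_congr_ae (ae_of_all _ fun ω => ?_); simp only [hX]; ring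
    have e2 : ∫ ω, Q₁ ω * Y ω ∂γ = (∫ ω, Q₁ ω * G' ω ∂γ) - ∫ ω, Q₁ ω * Q₂ ω ∂γ := by
      rw [← integral_sub hQ₁G'i hQ₁₂i]; refine integral_congr_ae (ae_of_all _ fun ω => ?_); simp only [hY]; ring
    have e3 : ∫ ω, X ω ∂γ = (∫ ω, F' ω ∂γ) - ∫ ω, Q₁ ω ∂γ := integral_sub hF'i hQ₁i
    have e4 : ∫ ω, Y ω ∂γ = (∫ ω, G' ω ∂γ) - ∫ ω, Q₂ ω ∂γ := integral_sub hG'i hQ₂i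
    rw [e1, e2, e3, e4]; ring
  rw [hsplit]
  have hsp0 : 0 ≤ Real.sqrt p := Real.sqrt_nonneg _
  calc |((∫ ω, X ω * G' ω ∂γ) - (∫ ω, X ω ∂γ) * (∫ ω, G' ω ∂γ)) + ((∫ ω, Q₁ ω * Y ω ∂γ) - (∫ ω, Q₁ ω ∂γ) * (∫ ω, Y ω ∂γ))|
      ≤ (|∫ ω, X ω * G' ω ∂γ| + |(∫ ω, X ω ∂γ) * (∫ ω, G' ω ∂γ)|) +
          (|∫ ω, Q₁ ω * Y ω ∂γ| + |(∫ ω, Q₁ ω ∂γ) * (∫ ω, Y ω ∂γ)|) :=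
        (abs_add_le _ _).trans (add_le_add (abs_sub _ _) (abs_sub _ _))
    _ ≤ (M * (τ + Real.sqrt p * K) + (τ + Real.sqrt p * K) * M) + ((τ * K + Real.sqrt p * K') + K * (τ + Real.sqrt p * K)) :=
        add_le_add (add_le_add hA hB) (add_le_add hC hD)
    _ = 2 * τ * (M + K) + Real.sqrt p * (2 * M * K + K' + K ^ 2) := by ring

/-! ## The main bookkeeping theorem -/

omit [IsProbabilityMeasure γ] in
/-- The conditioned measure does not charge the complement. -/
theorem cond_compl_eq_zero (S : Set Ω) (hS : MeasurableSet S) : (γ[|S]) Sᶜ = 0 := by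
  rw [cond_apply hS, Set.inter_compl_self, measure_empty, mul_zero]

/-- **R6 — covariance bookkeeping.**  With `ν = (γ[|S]).tilted (𝟙_S W)`, `|𝟙_S W| ≤ w`, `0 ≤ F, G ≤ M` on `S`, `|F − Q₁|, |G − Q₂| ≤ τ` on `S`,
`γ(Sᶜ) ≤ p`, `γ(S) ≠ 0`, and second moments `∫Q₁², ∫Q₂² ≤ K²`, `∫(Q₁Q₂)² ≤ K'²`:
`|Cov_ν(F,G) − Cov_γ(Q₁,Q₂)| ≤ 3M²(e^{2w} − 1) + 6M²p + 2τ(M+K) + √p(2MK + K' + K²)`. -/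
theorem abs_cov_tilted_cond_sub_cov_le {S : Set Ω} (hS : MeasurableSet S) (hS0 : γ S ≠ 0) {W : Ω → ℝ} (hWm : Measurable W)
    {w : ℝ} (hW : ∀ ω, |S.indicator W ω| ≤ w) {F G Q₁ Q₂ : Ω → ℝ} (hFm : Measurable F) (hGm : Measurable G)
    (hQ₁ : MemLp Q₁ 2 γ) (hQ₂ : MemLp Q₂ 2 γ) (hQ₁₂ : MemLp (fun ω => Q₁ ω * Q₂ ω) 2 γ)
    {M τ K K' p : ℝ} (hM : 0 ≤ M) (hτ : 0 ≤ τ) (hK : 0 ≤ K) (hK' : 0 ≤ K')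
    (hF : ∀ ω ∈ S, 0 ≤ F ω ∧ F ω ≤ M) (hG : ∀ ω ∈ S, 0 ≤ G ω ∧ G ω ≤ M)
    (hFQ : ∀ ω ∈ S, |F ω - Q₁ ω| ≤ τ) (hGQ : ∀ ω ∈ S, |G ω - Q₂ ω| ≤ τ)
    (hp : γ.real Sᶜ ≤ p) (hK₁ : ∫ ω, Q₁ ω ^ 2 ∂γ ≤ K ^ 2) (hK₂ : ∫ ω, Q₂ ω ^ 2 ∂γ ≤ K ^ 2)
    (hK₁₂ : ∫ ω, (Q₁ ω * Q₂ ω) ^ 2 ∂γ ≤ K' ^ 2) :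
    |((∫ ω, F ω * G ω ∂((γ[|S]).tilted (S.indicator W))) - (∫ ω, F ω ∂((γ[|S]).tilted (S.indicator W))) *
          (∫ ω, G ω ∂((γ[|S]).tilted (S.indicator W)))) -
        ((∫ ω, Q₁ ω * Q₂ ω ∂γ) - (∫ ω, Q₁ ω ∂γ) * (∫ ω, Q₂ ω ∂γ))| ≤
      3 * M ^ 2 * (exp (2 * w) - 1) + 6 * M ^ 2 * p + 2 * τ * (M + K) + Real.sqrt p * (2 * M * K + K' + K ^ 2) := by
  haveI : IsProbabilityMeasure (γ[|S]) := cond_isProbabilityMeasure hS0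
  set μS := γ[|S] with hμS
  set ν := μS.tilted (S.indicator W) with hν
  set F' := S.indicator F with hF'
  set G' := S.indicator G with hG'
  have hF'm : Measurable F' := hFm.indicator hS
  have hG'm : Measurable G' := hGm.indicator hS
  have hF'b : ∀ ω, |F' ω| ≤ M := fun ω => by
    by_cases hω : ω ∈ S
    · rw [hF', Set.indicator_of_mem hω, abs_of_nonneg (hF ω hω).1]; exact (hF ω hω).2
    · rw [hF', Set.indicator_of_notMem hω, abs_zero]; exact hM
  have hG'b : ∀ ω, |G' ω| ≤ M := fun ω => by
    by_cases hω : ω ∈ S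
    · rw [hG', Set.indicator_of_mem hω, abs_of_nonneg (hG ω hω).1]; exact (hG ω hω).2
    · rw [hG', Set.indicator_of_notMem hω, abs_zero]; exact hM
  -- (i) both `ν` and `μS` live on `S`: replace `F, G` by `F', G'`
  have hμSc : μS Sᶜ = 0 := cond_compl_eq_zero S hS
  have hνc : ν Sᶜ = 0 := (tilted_absolutelyContinuous μS _) hμSc
  have haeF : ∀ {μ : Measure Ω}, μ Sᶜ = 0 → (fun ω => F ω) =ᵐ[μ] F' := fun {μ} hμ => by
    refine (ae_iff.2 ?_)
    refine measure_mono_null (fun ω hω => ?_) hμ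
    intro hωS; exact hω (by rw [hF', Set.indicator_of_mem hωS])
  have haeG : ∀ {μ : Measure Ω}, μ Sᶜ = 0 → (fun ω => G ω) =ᵐ[μ] G' := fun {μ} hμ => by
    refine (ae_iff.2 ?_)
    refine measure_mono_null (fun ω hω => ?_) hμ
    intro hωS; exact hω (by rw [hG', Set.indicator_of_mem hωS])
  have hcovν : (∫ ω, F ω * G ω ∂ν) - (∫ ω, F ω ∂ν) * (∫ ω, G ω ∂ν) =
      (∫ ω, F' ω * G' ω ∂ν) - (∫ ω, F' ω ∂ν) * (∫ ω, G' ω ∂ν) := by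
    have hFG : (fun ω => F ω * G ω) =ᵐ[ν] fun ω => F' ω * G' ω :=
      (haeF hνc).mp ((haeG hνc).mono fun ω hGω hFω => by
        simp only at hFω hGω ⊢; rw [hFω, hGω])
    rw [integral_congr_ae hFG, integral_congr_ae (haeF hνc), integral_congr_ae (haeG hνc)]
  -- (ii) the tilt
  have hF'iS : Integrable F' μS := integrable_of_abs_le hF'm.aestronglyMeasurable hF'b
  have hG'iS : Integrable G' μS := integrable_of_abs_le hG'm.aestronglyMeasurable hG'b
  have hF'G'iS : Integrable (fun ω => F' ω * G' ω) μS :=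
    hG'iS.bdd_mul hF'm.aestronglyMeasurable (ae_of_all _ fun ω => by rw [Real.norm_eq_abs]; exact hF'b ω)
  have htilt := abs_cov_tilted_sub_le (ν := μS) (hWm.indicator hS) hW hF'iS hG'iS hF'G'iS hF'b hG'b
  -- (iii) the conditioning
  have hF'i : Integrable F' γ := integrable_of_abs_le hF'm.aestronglyMeasurable hF'b
  have hG'i : Integrable G' γ := integrable_of_abs_le hG'm.aestronglyMeasurable hG'b
  have hF'G'i : Integrable (fun ω => F' ω * G' ω) γ :=
    hG'i.bdd_mul hF'm.aestronglyMeasurable (ae_of_all _ fun ω => by rw [Real.norm_eq_abs]; exact hF'b ω)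
  have hcond := abs_cov_sub_cov_cond_le (μ := γ) hS hS0 hF'i hG'i hF'G'i hF'b hG'b
  -- (iv) the surrogates under `γ`
  have hFQ' : ∀ ω, |F' ω - Q₁ ω| ≤ τ + Sᶜ.indicator (fun ω => |Q₁ ω|) ω := fun ω => by
    by_cases hω : ω ∈ S
    · rw [hF', Set.indicator_of_mem hω, Set.indicator_of_notMem (Set.notMem_compl_iff.2 hω), add_zero]; exact hFQ ω hω
    · rw [hF', Set.indicator_of_notMem hω, Set.indicator_of_mem (Set.mem_compl hω), zero_sub, abs_neg]
      linarith
  have hGQ' : ∀ ω, |G' ω - Q₂ ω| ≤ τ + Sᶜ.indicator (fun ω => |Q₂ ω|) ω := fun ω => by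
    by_cases hω : ω ∈ S
    · rw [hG', Set.indicator_of_mem hω, Set.indicator_of_notMem (Set.notMem_compl_iff.2 hω), add_zero]; exact hGQ ω hω
    · rw [hG', Set.indicator_of_notMem hω, Set.indicator_of_mem (Set.mem_compl hω), zero_sub, abs_neg]
      linarith
  have hsur := abs_cov_sub_cov_surrogate_le (γ := γ) hS hF'm hG'm hQ₁ hQ₂ hQ₁₂ hM hτ hK hK' hF'b hG'b hFQ' hGQ' hp hK₁ hK₂ hK₁₂
  -- assemble
  rw [hcovν]
  have hpM : 6 * M * M * γ.real Sᶜ ≤ 6 * M ^ 2 * p := by nlinarith [measureReal_nonneg (μ := γ) (s := Sᶜ)]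
  have e3 : 3 * M * M * (exp (2 * w) - 1) = 3 * M ^ 2 * (exp (2 * w) - 1) := by ring
  calc |((∫ ω, F' ω * G' ω ∂ν) - (∫ ω, F' ω ∂ν) * (∫ ω, G' ω ∂ν)) - ((∫ ω, Q₁ ω * Q₂ ω ∂γ) - (∫ ω, Q₁ ω ∂γ) * (∫ ω, Q₂ ω ∂γ))|
      ≤ |((∫ ω, F' ω * G' ω ∂ν) - (∫ ω, F' ω ∂ν) * (∫ ω, G' ω ∂ν)) -
            ((∫ ω, F' ω * G' ω ∂μS) - (∫ ω, F' ω ∂μS) * (∫ ω, G' ω ∂μS))| +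
          |((∫ ω, F' ω * G' ω ∂μS) - (∫ ω, F' ω ∂μS) * (∫ ω, G' ω ∂μS)) -
            ((∫ ω, F' ω * G' ω ∂γ) - (∫ ω, F' ω ∂γ) * (∫ ω, G' ω ∂γ))| +
          |((∫ ω, F' ω * G' ω ∂γ) - (∫ ω, F' ω ∂γ) * (∫ ω, G' ω ∂γ)) -
            ((∫ ω, Q₁ ω * Q₂ ω ∂γ) - (∫ ω, Q₁ ω ∂γ) * (∫ ω, Q₂ ω ∂γ))| := abs_sub_le_add_three _ _ _ _
    _ ≤ 3 * M * M * (exp (2 * w) - 1) + 6 * M * M * γ.real Sᶜ +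
          (2 * τ * (M + K) + Real.sqrt p * (2 * M * K + K' + K ^ 2)) := by
        refine add_le_add (add_le_add htilt ?_) hsur
        rw [abs_sub_comm]; exact hcond
    _ ≤ _ := by linarith
where
  /-- `|a − d| ≤ |a − b| + |b − c| + |c − d|`. -/
  abs_sub_le_add_three (a b c d : ℝ) : |a - d| ≤ |a - b| + |b - c| + |c - d| :=
    (abs_sub_le a c d).trans (add_le_add (abs_sub_le a b c) le_rfl)

end Summit.QuantumFields.YangMills.Theorems.WeakCouplingRates

end
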